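import Literature.Combinatorics.Sahi2008.PushForward
import HarnessLib

/-!
# Kahn (2022), footnote 1 (a)–(b): one step of van den Berg's sequential coupling — the marginal,
# the monotone conditional probability, and threshold coins realising it exactly

CITATION HEADER.  Source: J. Kahn, *A note on positive association*, arXiv:2210.08653 (2022)
[Kahn2022], p. 2 footnote 1 (read 2026-08-19, `lit read arxiv:2210.08653`): "(a) Assuming the law,
`μ`, of `(X_1,…,X_n)` is FKG, let `Z_1,…,Z_n` be independent, each uniform from `[0,1]`, and for
`i = 1,…,n`, if `X_j = ω_j` for `j < i`, let `X_i = 1` iff `Z_i > 1 − μ(X_i = 0 | X_j = ω_j ∀ j < i)`.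
This is easily seen to return `μ` as the law of `(X_1,…,X_n)`, and it's not hard to see, using (1)
[the positive lattice condition], that the `X_i`'s are nondecreasing in the `Z_j`'s. (b) For each `i`,
the procedure in (a) depends on a finite number of events `A(i,j) := {Z_i > α_{i,j}}`, and it's easy to
realize the indicators `1_{A(i,j)}` … as nondecreasing functions of independent (nonidentical)
Bernoullis `Y_{i,j}`."  The full statement "FKG measures are FUI" and its consequence for Sahi's
conjecture are assembled in `Sahi2008/UnderlyingIndependents.lean`; this file is the single step,
on the cube `Fin (k+1) → Bool` (product order, `false < true`), peeling coordinate `0`.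

## Contents (everything PROVED; vocabulary of `Functional.lean` and `PushForward.lean`)

* `tailMarginal μ` — the law of the remaining coordinates; it is again an FKG probability weight
  (`isFKGMeasure_tailMarginal`: the two-point fibre case of the four functions theorem
  [AhlswedeDaykin1978]).
* `condProb μ ξ = μ(X_0 = 1 | tail = ξ)`; **monotone in `ξ` on the support** (`condProb_mono`) — the
  one place where the lattice condition (1) is used, exactly as in (a).
* (b) made exact and finite: the finitely many values `p(ξ) ∈ (0,1)` (`condValues`) are realised by
  the nested "all heads" events `Accept` of the ratio coins `thrCoin` of `PushForward.lean`:
  `P(Accept p(ξ)) = p(ξ)` (`sum_coinWeight_accept`).  Kahn's uniform `Z_i` is thereby replaced by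
  finitely many non-degenerate coins, so no limit is taken anywhere.
* `stepMap`/`stepCoins`: from a monotone coin representation `G₁` of the tail marginal, the map
  `y ↦ (1{Accept p(G₁ y₁) y₂}, G₁ y₁)` on the appended coins is MONOTONE (`stepMap_mono`) and its law
  is exactly `μ` (`pushWeight_stepMap`: "this is easily seen to return `μ`").
-/
noncomputable section

namespace Literature.Combinatorics.Sahi2008

open Finset

/-! ### Boolean tuples: `Fin.cons` and the lattice operations -/

section Cons

variable {k : ℕ}

/-- `cons` commutes with `⊓` (plumbing). [folklore] -/
private theorem cons_inf_cons (a b : Bool) (ξ η : Fin k → Bool) :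
    (Fin.cons a ξ : Fin (k + 1) → Bool) ⊓ Fin.cons b η = Fin.cons (a ⊓ b) (ξ ⊓ η) := by
  funext i
  refine Fin.cases ?_ (fun j => ?_) i
  · simp only [Pi.inf_apply, Fin.cons_zero]
  · simp only [Pi.inf_apply, Fin.cons_succ]

/-- `cons` commutes with `⊔` (plumbing). [folklore] -/
private theorem cons_sup_cons (a b : Bool) (ξ η : Fin k → Bool) :
    (Fin.cons a ξ : Fin (k + 1) → Bool) ⊔ Fin.cons b η = Fin.cons (a ⊔ b) (ξ ⊔ η) := by
  funext i
  refine Fin.cases ?_ (fun j => ?_) i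
  · simp only [Pi.sup_apply, Fin.cons_zero]
  · simp only [Pi.sup_apply, Fin.cons_succ]

end Cons

/-! ### Step (a): the marginal on the tail and the conditional probability of coordinate `0` -/

section Step

variable {k : ℕ}

/-- The marginal of `μ` on the coordinates `1,…,k` (coordinate `0` summed out):
`ν(ξ) = μ(0ξ) + μ(1ξ)` — the law of "`X_j`, `j < i`" in Kahn's footnote (we peel the FIRST coordinate).
[cite: Kahn2022, p. 2 footnote 1 (a)] -/
def tailMarginal (μ : (Fin (k + 1) → Bool) → ℝ) (ξ : Fin k → Bool) : ℝ :=
  μ (Fin.cons false ξ) + μ (Fin.cons true ξ)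

/-- The marginal of a nonnegative weight is nonnegative. [cite: Kahn2022, p. 2 footnote 1 (a)] -/
theorem tailMarginal_nonneg {μ : (Fin (k + 1) → Bool) → ℝ} (h0 : ∀ x, 0 ≤ μ x) (ξ : Fin k → Bool) :
    0 ≤ tailMarginal μ ξ :=
  add_nonneg (h0 _) (h0 _)

/-- Each fibre point is bounded by the marginal. [cite: Kahn2022, p. 2 footnote 1 (a)] -/
theorem apply_cons_le_tailMarginal {μ : (Fin (k + 1) → Bool) → ℝ} (h0 : ∀ x, 0 ≤ μ x) (b : Bool)
    (ξ : Fin k → Bool) : μ (Fin.cons b ξ) ≤ tailMarginal μ ξ := by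
  cases b
  · exact le_add_of_nonneg_right (h0 _)
  · exact le_add_of_nonneg_left (h0 _)

/-- The marginal has the same total mass. [cite: Kahn2022, p. 2 footnote 1 (a)] -/
theorem sum_tailMarginal (μ : (Fin (k + 1) → Bool) → ℝ) : ∑ ξ, tailMarginal μ ξ = ∑ x, μ x := by
  have h : ∑ x, μ x = ∑ p : Bool × (Fin k → Bool), μ (Fin.cons p.1 p.2) :=
    (Fintype.sum_equiv (Fin.consEquiv fun _ => Bool) (fun p => μ (Fin.cons p.1 p.2)) μ
      (fun p => rfl)).symm
  rw [h, Fintype.sum_prod_type, Fintype.sum_bool, ← sum_add_distrib]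
  exact sum_congr rfl fun ξ _ => add_comm _ _

/-- The two-point Ahlswede–Daykin inequality (plumbing for the marginal): from `X, Y ≤ P` and
`XY ≤ PQ` (all nonnegative) conclude `X + Y ≤ P + Q`. [folklore] -/
private theorem add_le_add_of_mul_le {X Y P Q : ℝ} (hX0 : 0 ≤ X) (hY0 : 0 ≤ Y) (hP0 : 0 ≤ P)
    (hQ0 : 0 ≤ Q) (hX : X ≤ P) (hY : Y ≤ P) (hXY : X * Y ≤ P * Q) : X + Y ≤ P + Q := by
  rcases hP0.eq_or_lt with h | hP
  · have hX' : X = 0 := le_antisymm (h ▸ hX) hX0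
    have hY' : Y = 0 := le_antisymm (h ▸ hY) hY0
    rw [hX', hY', ← h]
    simpa using hQ0
  · nlinarith [mul_nonneg (sub_nonneg.2 hX) (sub_nonneg.2 hY)]

/-- **The marginal of an FKG weight is FKG** (the two-point fibre case of the four functions theorem
[AhlswedeDaykin1978]: summing out one Boolean coordinate preserves the positive lattice condition).
[cite: Kahn2022, p. 1 eq. (1) and p. 2 footnote 1 (a); AhlswedeDaykin1978, Thm. 1] -/
theorem isFKGMeasure_tailMarginal {μ : (Fin (k + 1) → Bool) → ℝ} (hμ : IsFKGMeasure μ) :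
    IsFKGMeasure (tailMarginal μ) where
  nonneg := tailMarginal_nonneg hμ.nonneg
  sum_eq_one := by rw [sum_tailMarginal, hμ.sum_eq_one]
  mul_le_mul ξ η := by
    have h0 := hμ.nonneg
    have h00 := hμ.mul_le_mul (Fin.cons false ξ) (Fin.cons false η)
    have h11 := hμ.mul_le_mul (Fin.cons true ξ) (Fin.cons true η)
    have h01 := hμ.mul_le_mul (Fin.cons false ξ) (Fin.cons true η)
    have h10 := hμ.mul_le_mul (Fin.cons true ξ) (Fin.cons false η)
    rw [cons_inf_cons, cons_sup_cons] at h00 h11 h01 h10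
    rw [show ((false : Bool) ⊓ false) = false from rfl, show ((false : Bool) ⊔ false) = false from rfl] at h00
    rw [show ((true : Bool) ⊓ true) = true from rfl, show ((true : Bool) ⊔ true) = true from rfl] at h11
    rw [show ((false : Bool) ⊓ true) = false from rfl, show ((false : Bool) ⊔ true) = true from rfl] at h01
    rw [show ((true : Bool) ⊓ false) = false from rfl, show ((true : Bool) ⊔ false) = true from rfl] at h10
    unfold tailMarginal
    -- (a0 + a1)(b0 + b1) ≤ (m0 + m1)(M0 + M1)
    have hmix : μ (Fin.cons false ξ) * μ (Fin.cons true η) + μ (Fin.cons true ξ) * μ (Fin.cons false η) ≤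
        μ (Fin.cons false (ξ ⊓ η)) * μ (Fin.cons true (ξ ⊔ η)) +
          μ (Fin.cons true (ξ ⊓ η)) * μ (Fin.cons false (ξ ⊔ η)) := by
      refine add_le_add_of_mul_le (mul_nonneg (h0 _) (h0 _)) (mul_nonneg (h0 _) (h0 _))
        (mul_nonneg (h0 _) (h0 _)) (mul_nonneg (h0 _) (h0 _)) h01 h10 ?_
      calc μ (Fin.cons false ξ) * μ (Fin.cons true η) * (μ (Fin.cons true ξ) * μ (Fin.cons false η))
          = (μ (Fin.cons false ξ) * μ (Fin.cons false η)) * (μ (Fin.cons true ξ) * μ (Fin.cons true η)) := by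
            ring
        _ ≤ (μ (Fin.cons false (ξ ⊓ η)) * μ (Fin.cons false (ξ ⊔ η))) *
              (μ (Fin.cons true (ξ ⊓ η)) * μ (Fin.cons true (ξ ⊔ η))) :=
            mul_le_mul h00 h11 (mul_nonneg (h0 _) (h0 _)) (mul_nonneg (h0 _) (h0 _))
        _ = μ (Fin.cons false (ξ ⊓ η)) * μ (Fin.cons true (ξ ⊔ η)) *
              (μ (Fin.cons true (ξ ⊓ η)) * μ (Fin.cons false (ξ ⊔ η))) := by ring
    nlinarith [hmix, h00, h11]

/-- **The conditional probability** `p(ξ) = μ(X_0 = 1 | tail = ξ) = μ(1ξ)/ν(ξ)` (junk value `0` when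
`ν(ξ) = 0`); Kahn's `1 − μ(X_i = 0 | X_j = ω_j ∀ j < i)`. [cite: Kahn2022, p. 2 footnote 1 (a)] -/
def condProb (μ : (Fin (k + 1) → Bool) → ℝ) (ξ : Fin k → Bool) : ℝ :=
  μ (Fin.cons true ξ) / tailMarginal μ ξ

/-- `0 ≤ p(ξ)`. [cite: Kahn2022, p. 2 footnote 1 (a)] -/
theorem condProb_nonneg {μ : (Fin (k + 1) → Bool) → ℝ} (h0 : ∀ x, 0 ≤ μ x) (ξ : Fin k → Bool) :
    0 ≤ condProb μ ξ :=
  div_nonneg (h0 _) (tailMarginal_nonneg h0 ξ)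

/-- `p(ξ) ≤ 1`. [cite: Kahn2022, p. 2 footnote 1 (a)] -/
theorem condProb_le_one {μ : (Fin (k + 1) → Bool) → ℝ} (h0 : ∀ x, 0 ≤ μ x) (ξ : Fin k → Bool) :
    condProb μ ξ ≤ 1 :=
  div_le_one_of_le₀ (apply_cons_le_tailMarginal h0 true ξ) (tailMarginal_nonneg h0 ξ)

/-- `ν(ξ)·p(ξ) = μ(1ξ)` on the support. [cite: Kahn2022, p. 2 footnote 1 (a)] -/
theorem tailMarginal_mul_condProb {μ : (Fin (k + 1) → Bool) → ℝ} {ξ : Fin k → Bool}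
    (hξ : 0 < tailMarginal μ ξ) : tailMarginal μ ξ * condProb μ ξ = μ (Fin.cons true ξ) := by
  rw [condProb, mul_div_assoc', mul_div_cancel_left₀ _ hξ.ne']

/-- `ν(ξ)·(1 − p(ξ)) = μ(0ξ)` on the support. [cite: Kahn2022, p. 2 footnote 1 (a)] -/
theorem tailMarginal_mul_one_sub_condProb {μ : (Fin (k + 1) → Bool) → ℝ} {ξ : Fin k → Bool}
    (hξ : 0 < tailMarginal μ ξ) :
    tailMarginal μ ξ * (1 - condProb μ ξ) = μ (Fin.cons false ξ) := by
  rw [mul_sub, mul_one, tailMarginal_mul_condProb hξ, tailMarginal, add_sub_cancel_right]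

/-- **"Using (1), the `X_i`'s are nondecreasing"**: on the support of the marginal the conditional
probability `p(ξ)` is monotone in `ξ` — the one place where the lattice condition of `μ` enters.
[cite: Kahn2022, p. 2 footnote 1 (a)] -/
theorem condProb_mono {μ : (Fin (k + 1) → Bool) → ℝ} (hμ : IsFKGMeasure μ) {ξ η : Fin k → Bool}
    (hle : ξ ≤ η) (hξ : 0 < tailMarginal μ ξ) (hη : 0 < tailMarginal μ η) :
    condProb μ ξ ≤ condProb μ η := by
  have h := hμ.mul_le_mul (Fin.cons true ξ) (Fin.cons false η)
  rw [cons_inf_cons, cons_sup_cons, inf_eq_left.2 hle, sup_eq_right.2 hle] at h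
  rw [show ((true : Bool) ⊓ false) = false from rfl, show ((true : Bool) ⊔ false) = true from rfl] at h
  unfold condProb
  rw [div_le_div_iff₀ hξ hη]
  unfold tailMarginal
  nlinarith [h, hμ.nonneg (Fin.cons true ξ), hμ.nonneg (Fin.cons true η)]

/-! ### Step (b): the finitely many conditional probabilities in `(0,1)` and their threshold coins -/

/-- The finite set `C` of values `p(ξ) ∈ (0,1)` at tail points of positive marginal mass (Kahn's
thresholds `α_{i,j}`). [cite: Kahn2022, p. 2 footnote 1 (b)] -/
def condValues (μ : (Fin (k + 1) → Bool) → ℝ) : Finset ℝ :=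
  ((univ.filter fun ξ => 0 < tailMarginal μ ξ).image (condProb μ)).filter fun c => 0 < c ∧ c < 1

/-- The number of threshold coins. [cite: Kahn2022, p. 2 footnote 1 (b)] -/
abbrev numThr (μ : (Fin (k + 1) → Bool) → ℝ) : ℕ := (condValues μ).card

/-- The threshold coins: the ratio coins of the decreasing enumeration of `C`.
[cite: Kahn2022, p. 2 footnote 1 (b)] -/
def thrCoin (μ : (Fin (k + 1) → Bool) → ℝ) (i : Fin (numThr μ)) : ℝ :=
  ratioCoin (decEnum (condValues μ)) i

/-- Values of `C` lie in `(0,1)`. [cite: Kahn2022, p. 2 footnote 1 (b)] -/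
theorem decEnum_condValues_mem {μ : (Fin (k + 1) → Bool) → ℝ} {j : ℕ} (hj : j < numThr μ) :
    0 < decEnum (condValues μ) j ∧ decEnum (condValues μ) j < 1 := by
  have h := decEnum_mem (condValues μ) hj
  unfold condValues at h
  exact (mem_filter.1 h).2

/-- The threshold coins are non-degenerate. [cite: Kahn2022, p. 2 footnote 1 (b)] -/
theorem thrCoin_mem_Ioo (μ : (Fin (k + 1) → Bool) → ℝ) :
    ∀ i, 0 < thrCoin μ i ∧ thrCoin μ i < 1 := fun i =>
  ratioCoin_mem_Ioo (decEnum (condValues μ)) (fun _ hj => (decEnum_condValues_mem hj).1)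
    (fun _ hj => (decEnum_condValues_mem hj).2) (fun _ _ hij hj => decEnum_lt_decEnum _ hij hj) i i.2

/-- **Acceptance** of coordinate `0` given the target probability `p` and the threshold coins `y`:
`p > 0` and every coin whose value is at least `p` shows heads (Kahn's `{Z_i > 1 − p}` realised on the
finitely many relevant thresholds). [cite: Kahn2022, p. 2 footnote 1 (b)] -/
def Accept (μ : (Fin (k + 1) → Bool) → ℝ) (p : ℝ) (y : Fin (numThr μ) → Bool) : Prop :=
  0 < p ∧ ∀ i : Fin (numThr μ), p ≤ decEnum (condValues μ) i → y i = true

/-- Acceptance is monotone in the target probability and in the coins.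
[cite: Kahn2022, p. 2 footnote 1 (a)–(b)] -/
theorem Accept.mono {μ : (Fin (k + 1) → Bool) → ℝ} {p p' : ℝ} {y y' : Fin (numThr μ) → Bool}
    (hp : p ≤ p') (hy : y ≤ y') (h : Accept μ p y) : Accept μ p' y' := by
  refine ⟨lt_of_lt_of_le h.1 hp, fun i hi => ?_⟩
  have hyi : y i ≤ y' i := hy i
  exact Bool.le_iff_imp.1 hyi (h.2 i (le_trans hp hi))

open Classical in
/-- **The thresholds realise the conditional probabilities exactly**: for a tail point `ξ` of positive
marginal mass, `P(Accept p(ξ)) = p(ξ)` under the threshold coins.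
[cite: Kahn2022, p. 2 footnote 1 (b)] -/
theorem sum_coinWeight_accept {μ : (Fin (k + 1) → Bool) → ℝ} (h0 : ∀ x, 0 ≤ μ x) {ξ : Fin k → Bool}
    (hξ : 0 < tailMarginal μ ξ) :
    ∑ y, (if Accept μ (condProb μ ξ) y then coinWeight (thrCoin μ) y else 0) = condProb μ ξ := by
  set p := condProb μ ξ with hp
  have hp0 : 0 ≤ p := condProb_nonneg h0 ξ
  have hp1 : p ≤ 1 := condProb_le_one h0 ξ
  rcases hp0.eq_or_lt with hz | hpos
  · -- p = 0: never accepted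
    have hacc : ∀ y, ¬ Accept μ p y := fun y h => absurd h.1 (by rw [← hz]; exact lt_irrefl 0)
    rw [sum_eq_zero fun y _ => if_neg (hacc y)]
    exact hz
  rcases hp1.eq_or_lt with ho | hlt
  · -- p = 1: always accepted
    have hacc : ∀ y, Accept μ p y := fun y =>
      ⟨hpos, fun i hi => absurd (lt_of_lt_of_le (decEnum_condValues_mem i.2).2 (ho ▸ hi)) (lt_irrefl _)⟩
    rw [show (∑ y, if Accept μ p y then coinWeight (thrCoin μ) y else 0) =
        ∑ y, coinWeight (thrCoin μ) y from sum_congr rfl fun y _ => if_pos (hacc y), sum_coinWeight]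
    exact ho.symm
  · -- 0 < p < 1: p is one of the enumerated values
    have hmem : p ∈ condValues μ := by
      unfold condValues
      refine mem_filter.2 ⟨mem_image.2 ⟨ξ, mem_filter.2 ⟨mem_univ _, hξ⟩, rfl⟩, hpos, hlt⟩
    obtain ⟨j, hj, hjp⟩ := exists_decEnum_eq (condValues μ) hmem
    have hiff : ∀ y : Fin (numThr μ) → Bool,
        Accept μ p y ↔ ∀ i : Fin (numThr μ), (i : ℕ) ≤ j → y i = true := by
      intro y
      constructor
      · intro h i hi
        exact h.2 i (by rw [← hjp]; exact (decEnum_le_decEnum_iff _ i.2 hj).2 hi)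
      · intro h
        refine ⟨hpos, fun i hi => h i ?_⟩
        rw [← hjp] at hi
        exact (decEnum_le_decEnum_iff _ i.2 hj).1 hi
    have hne : ∀ j' < numThr μ, decEnum (condValues μ) j' ≠ 0 :=
      fun j' hj' => (decEnum_condValues_mem hj').1.ne'
    have hsum : (∑ y, if Accept μ p y then coinWeight (thrCoin μ) y else 0) =
        ∑ y : Fin (numThr μ) → Bool, (if ∀ i : Fin (numThr μ), (i : ℕ) ≤ j → y i = true then
          coinWeight (fun i : Fin (numThr μ) => ratioCoin (decEnum (condValues μ)) i) y else 0) := by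
      refine sum_congr rfl fun y _ => ?_
      by_cases hy : Accept μ p y
      · rw [if_pos hy, if_pos ((hiff y).1 hy)]
        rfl
      · rw [if_neg hy, if_neg (fun h => hy ((hiff y).2 h))]
    rw [hsum, sum_coinWeight_prefix (decEnum (condValues μ)) hne hj, hjp]

open Classical in
/-- The complementary sum: `P(¬Accept p(ξ)) = 1 − p(ξ)`. [cite: Kahn2022, p. 2 footnote 1 (b)] -/
theorem sum_coinWeight_not_accept {μ : (Fin (k + 1) → Bool) → ℝ} (h0 : ∀ x, 0 ≤ μ x)
    {ξ : Fin k → Bool} (hξ : 0 < tailMarginal μ ξ) :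
    ∑ y, (if ¬ Accept μ (condProb μ ξ) y then coinWeight (thrCoin μ) y else 0) = 1 - condProb μ ξ := by
  have h1 := sum_coinWeight_accept h0 hξ
  have h2 : (∑ y, if Accept μ (condProb μ ξ) y then coinWeight (thrCoin μ) y else 0) +
      (∑ y, if ¬ Accept μ (condProb μ ξ) y then coinWeight (thrCoin μ) y else 0) = 1 := by
    rw [← sum_filter, ← sum_filter, sum_filter_add_sum_filter_not, sum_coinWeight]
  linarith

/-! ### The new map: coins for the tail, then threshold coins for coordinate `0` -/

open Classical in
/-- One step of the construction: given a representation `G₁` of the tail marginal by coins indexed by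
`Fin m`, append the `numThr μ` threshold coins and set
`X_0 := 1{Accept p(G₁ y₁) y₂}`, tail `:= G₁ y₁`. [cite: Kahn2022, p. 2 footnote 1 (a)–(b)] -/
def stepMap (μ : (Fin (k + 1) → Bool) → ℝ) {m : ℕ} (G₁ : (Fin m → Bool) → (Fin k → Bool))
    (y : Fin (m + numThr μ) → Bool) : Fin (k + 1) → Bool :=
  Fin.cons (decide (Accept μ (condProb μ (G₁ fun i => y (Fin.castAdd (numThr μ) i)))
      (fun j => y (Fin.natAdd m j))))
    (G₁ fun i => y (Fin.castAdd (numThr μ) i))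

/-- The coins of the step: the old coins followed by the threshold coins.
[cite: Kahn2022, p. 2 footnote 1 (b)] -/
def stepCoins (μ : (Fin (k + 1) → Bool) → ℝ) {m : ℕ} (q₁ : Fin m → ℝ) : Fin (m + numThr μ) → ℝ :=
  Fin.append q₁ (thrCoin μ)

open Classical in
/-- The step map on an appended configuration. [cite: Kahn2022, p. 2 footnote 1 (a)–(b)] -/
theorem stepMap_append (μ : (Fin (k + 1) → Bool) → ℝ) {m : ℕ} (G₁ : (Fin m → Bool) → (Fin k → Bool))
    (y₁ : Fin m → Bool) (y₂ : Fin (numThr μ) → Bool) :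
    stepMap μ G₁ (Fin.append y₁ y₂) =
      Fin.cons (decide (Accept μ (condProb μ (G₁ y₁)) y₂)) (G₁ y₁) := by
  have h1 : (fun i => Fin.append y₁ y₂ (Fin.castAdd (numThr μ) i)) = y₁ :=
    funext fun i => Fin.append_left y₁ y₂ i
  have h2 : (fun j => Fin.append y₁ y₂ (Fin.natAdd m j)) = y₂ :=
    funext fun j => Fin.append_right y₁ y₂ j
  unfold stepMap
  rw [h1, h2]

/-- **Monotonicity of the step** ("the `X_i`'s are nondecreasing in the `Z_j`'s"): if `G₁` is monotone
and represents the tail marginal by non-degenerate coins, the step map is monotone.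
[cite: Kahn2022, p. 2 footnote 1 (a)] -/
theorem stepMap_mono {μ : (Fin (k + 1) → Bool) → ℝ} (hμ : IsFKGMeasure μ) {m : ℕ} {q₁ : Fin m → ℝ}
    (hq₁ : ∀ i, 0 < q₁ i ∧ q₁ i < 1) {G₁ : (Fin m → Bool) → (Fin k → Bool)} (hG₁ : Monotone G₁)
    (hrep : tailMarginal μ = pushWeight (coinWeight q₁) G₁) : Monotone (stepMap μ G₁) := by
  classical
  have hsupp : ∀ y₁, 0 < tailMarginal μ (G₁ y₁) := fun y₁ => by
    rw [hrep]
    exact lt_of_lt_of_le (coinWeight_pos hq₁ y₁)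
      (le_pushWeight_apply (fun y => (coinWeight_pos hq₁ y).le) G₁ y₁)
  intro y y' hyy'
  have h1 : (fun i => y (Fin.castAdd (numThr μ) i)) ≤ fun i => y' (Fin.castAdd (numThr μ) i) :=
    fun i => hyy' _
  have h2 : (fun j => y (Fin.natAdd m j)) ≤ fun j => y' (Fin.natAdd m j) := fun j => hyy' _
  have hG := hG₁ h1
  unfold stepMap
  refine Fin.cons_le_cons.2 ⟨?_, hG⟩
  refine Bool.le_iff_imp.2 fun hacc => ?_
  rw [decide_eq_true_eq] at hacc ⊢
  exact hacc.mono (condProb_mono hμ hG (hsupp _) (hsupp _)) h2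

/-- **The law is returned exactly** ("this is easily seen to return `μ`"): the push-forward of the
appended coins along the step map is `μ`. [cite: Kahn2022, p. 2 footnote 1 (a)] -/
theorem pushWeight_stepMap {μ : (Fin (k + 1) → Bool) → ℝ} (hμ : IsFKGMeasure μ) {m : ℕ}
    {q₁ : Fin m → ℝ} {G₁ : (Fin m → Bool) → (Fin k → Bool)}
    (hrep : tailMarginal μ = pushWeight (coinWeight q₁) G₁) :
    pushWeight (coinWeight (stepCoins μ q₁)) (stepMap μ G₁) = μ := by
  classical
  have h0 := hμ.nonneg
  funext x
  obtain ⟨b, ξ, rfl⟩ : ∃ (b : Bool) (ξ : Fin k → Bool), x = Fin.cons b ξ :=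
    ⟨x 0, Fin.tail x, (Fin.cons_self_tail x).symm⟩
  rw [pushWeight_apply]
  -- reindex the cube `Fin (m + r) → Bool` by pairs
  rw [← Fintype.sum_equiv (Fin.appendEquiv m (numThr μ))
    (fun p => if stepMap μ G₁ (Fin.append p.1 p.2) = Fin.cons b ξ then
      coinWeight (stepCoins μ q₁) (Fin.append p.1 p.2) else 0) _ (fun p => rfl)]
  simp only [stepMap_append, stepCoins, coinWeight_append, Fin.cons_inj]
  rw [Fintype.sum_prod_type]
  -- inner sum: factor the tail coin and replace `G₁ y₁` by `ξ`
  have hinner : ∀ y₁ : Fin m → Bool,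
      (∑ y₂ : Fin (numThr μ) → Bool,
        if decide (Accept μ (condProb μ (G₁ y₁)) y₂) = b ∧ G₁ y₁ = ξ then
          coinWeight q₁ y₁ * coinWeight (thrCoin μ) y₂ else 0) =
      (if G₁ y₁ = ξ then coinWeight q₁ y₁ else 0) *
        ∑ y₂ : Fin (numThr μ) → Bool,
          if decide (Accept μ (condProb μ ξ) y₂) = b then coinWeight (thrCoin μ) y₂ else 0 := by
    intro y₁
    by_cases hy : G₁ y₁ = ξ
    · rw [if_pos hy, mul_sum]
      refine sum_congr rfl fun y₂ _ => ?_
      rw [hy]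
      by_cases hb : decide (Accept μ (condProb μ ξ) y₂) = b
      · rw [if_pos ⟨hb, rfl⟩, if_pos hb]
      · rw [if_neg (fun h => hb h.1), if_neg hb, mul_zero]
    · rw [if_neg hy, zero_mul]
      exact sum_eq_zero fun y₂ _ => if_neg fun h => hy h.2
  simp only [hinner]
  rw [← sum_mul, ← pushWeight_apply, ← hrep]
  -- now split on the marginal mass of `ξ`
  rcases (tailMarginal_nonneg h0 ξ).eq_or_lt with hz | hpos
  · rw [← hz, zero_mul]
    exact le_antisymm (h0 _) (hz ▸ apply_cons_le_tailMarginal h0 b ξ)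
  · cases b
    · have hs : (∑ y₂ : Fin (numThr μ) → Bool,
          if decide (Accept μ (condProb μ ξ) y₂) = false then coinWeight (thrCoin μ) y₂ else 0) =
          ∑ y₂, if ¬ Accept μ (condProb μ ξ) y₂ then coinWeight (thrCoin μ) y₂ else 0 :=
        sum_congr rfl fun y₂ _ => by simp only [decide_eq_false_iff_not]
      rw [hs, sum_coinWeight_not_accept h0 hpos, tailMarginal_mul_one_sub_condProb hpos]
    · have hs : (∑ y₂ : Fin (numThr μ) → Bool,
          if decide (Accept μ (condProb μ ξ) y₂) = true then coinWeight (thrCoin μ) y₂ else 0) =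
          ∑ y₂, if Accept μ (condProb μ ξ) y₂ then coinWeight (thrCoin μ) y₂ else 0 :=
        sum_congr rfl fun y₂ _ => by simp only [decide_eq_true_eq]
      rw [hs, sum_coinWeight_accept h0 hpos, tailMarginal_mul_condProb hpos]

end Step

end Literature.Combinatorics.Sahi2008
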